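import Mathlib

/-!
# RGPhasePrecision — the PRECISION PRICE OF DEPTH for a designed cascade: a level map that
# multiplies errors by `Λ > 1` per level lets a seed shadow the machine for `K` levels only from a
# distance `≤ δ · Λ^(−K)`, and (Lipschitz side) that precision also suffices   (FLUID COMPUTER cell,
# prover seat pub-fluidc-p2 gen 4; the typed twin of idea-1's pre-committed words for P-G10-1 (h))

HONEST FRAMING: low prior, high value-of-information experiment on Tao's machine paradigm;
NOT a claim that NS blows up.

Dictionary.  `RGFixedPoint.lean` (idea-1 gen 10) types a cascade MACHINE as a fixed point, modulo
symmetry, of the renormalised level map `M = N_E ∘ D₂ ∘ P_out ∘ Φ_T` on the in-band energy sphere, and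
what power iteration of `M` can show.  p1's A-G10-1 run of that iteration (kit j200241, deposit
`atlas/rung-next/p1/rgmap/`, STATUS l.4337; scored by idea-1 l.4342) found no fixed point, one statistical
attractor class with mean gain `0.58 ≈ λ^(−0.79)`, and — from the 0.02-rad phase twin of the certified
optimum — a per-level error multiplier `Λ_M ≈ 2.5` (twin distance `0.018 → 0.042 → 0.125 → 0.314 → 0.711`,
saturated by level 5).  idea-1's words, committed BEFORE the run (PREREG-R2.md §10w, P-G10-1 (h)):
"a K-level designed cascade needs phase precision `~ Λ_M^(−K)`" (ten levels: `~ 10⁻⁴` rad).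

This file types the arithmetic behind those words over an abstract error sequence / an abstract self-map
of a metric space; nothing about Navier–Stokes is asserted and no new hypothesis about NS is introduced:

* `le_of_expansive` — NECESSITY CORE: if the level-`k` error obeys `Λ · e k ≤ e (k+1)` whenever it is
  still inside the controlled tube (`e k ≤ δ₀`), and the ladder stays in the tube through level `K − 1`,
  then `Λ^K · e 0 ≤ e K`; hence `precision_floor` (`e K ≤ δ` forces `e 0 ≤ δ / Λ^K`) and
  `levels_le_log` (a seed at distance `ε > 0` shadows at most `log (δ/ε) / log Λ` levels);
* `dist_iterate_ge` / `dist_precision_floor` — the same for the orbit distance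
  `dist (M^[k] v) (M^[k] w)` of a self-map `M` that expands by `Λ` near the machine orbit of `w`;
* `le_of_lipschitz_noise` — SUFFICIENCY SIDE (discrete Grönwall): `e (k+1) ≤ L · e k + σ` gives
  `e K ≤ L^K · e 0 + σ (L^K − 1)/(L − 1)`; hence `within_of_precision`: initial precision
  `δ/(2 L^K)` and per-level noise `δ (L − 1)/(2 L^K)` keep level `K` within `δ` — the same `L^(−K)` law,
  so for a map that is both `Λ`-expansive near the orbit and `L`-Lipschitz the depth price is pinned
  between `Λ^(−K)` and `L^(−K)`;
* `tenLevels_numbers` — the cell's pins: `Λ = 2.5` ⇒ `1.0e-4 < 2.5^(−10) < 1.05e-4` and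
  `2.5^10 ≤ 10⁴ < 2.5^11` (a seed `10⁻⁴` away holds at most ten levels within `O(1)`).

Relation to the floors of this directory: `LevelReynoldsFloor` / `SaturationRelay` say a blow-up must
saturate and relay infinitely many levels; `RGFixedPoint` says a machine is a relative fixed point of `M`;
this file says how precisely a DESIGNED seed must sit on such a fixed point's stable data to realise `K`
of those levels when the fixed point is unstable with multiplier `Λ` — the measured situation of A-G10-1.
About an abstract map with the stated expansion / Lipschitz hypotheses; the identification with the
cell's `M` and the value `Λ_M = 2.52` are p1's / idea-1's measurements, not theorems.
Prior art (prose): shadowing-time vs precision for expansive maps is textbook (Bowen; Hammel–Yorke–Grebogi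
1987 for numerical orbits); nothing here is new mathematics.  0 sorry; elementary (induction + `Real.log`).
-/

noncomputable section

open Function

namespace Summit.NavierStokesRegularity.FluidComputer.RGPhasePrecision

/-! ## Necessity: expansion compounds -/

/-- **Expansion compounds along a ladder that stays in the tube.**  If `Λ · e k ≤ e (k+1)` at every level
`k < K` at which the error is still inside the controlled tube (`e k ≤ δ₀`), and the error IS inside the
tube at every level `k < K`, then `Λ^K · e 0 ≤ e K`. -/
theorem le_of_expansive {e : ℕ → ℝ} {Λ δ₀ : ℝ} (hΛ : 0 ≤ Λ) {K : ℕ}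
    (hexp : ∀ k < K, e k ≤ δ₀ → Λ * e k ≤ e (k + 1))
    (htube : ∀ k < K, e k ≤ δ₀) :
    Λ ^ K * e 0 ≤ e K := by
  induction K with
  | zero => simp
  | succ K ih =>
    have h1 : Λ ^ K * e 0 ≤ e K :=
      ih (fun k hk h => hexp k (by omega) h) (fun k hk => htube k (by omega))
    have h2 : Λ * e K ≤ e (K + 1) := hexp K (by omega) (htube K (by omega))
    calc Λ ^ (K + 1) * e 0 = Λ * (Λ ^ K * e 0) := by ring
      _ ≤ Λ * e K := mul_le_mul_of_nonneg_left h1 hΛ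
      _ ≤ e (K + 1) := h2

/-- **Precision floor (P-G10-1 (h), typed).**  Under the hypotheses of `le_of_expansive` with `Λ > 1`,
holding level `K` within tolerance `δ` (`e K ≤ δ`) forces the initial error to be at most `δ / Λ^K`:
a `K`-level designed cascade on an unstable machine needs precision `~ Λ^(−K)`. -/
theorem precision_floor {e : ℕ → ℝ} {Λ δ₀ δ : ℝ} (hΛ : 1 < Λ) {K : ℕ}
    (hexp : ∀ k < K, e k ≤ δ₀ → Λ * e k ≤ e (k + 1))
    (htube : ∀ k < K, e k ≤ δ₀) (hend : e K ≤ δ) :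
    e 0 ≤ δ / Λ ^ K := by
  have hΛK : 0 < Λ ^ K := pow_pos (by linarith) K
  have h := le_of_expansive (le_of_lt (lt_trans zero_lt_one hΛ)) hexp htube
  rw [le_div_iff₀ hΛK]
  calc e 0 * Λ ^ K = Λ ^ K * e 0 := mul_comm _ _
    _ ≤ e K := h
    _ ≤ δ := hend

/-- **Depth budget.**  Same hypotheses, with a genuinely mis-set seed (`0 < e 0`): the number of levels
held within `δ` is at most `log (δ / e 0) / log Λ`. -/
theorem levels_le_log {e : ℕ → ℝ} {Λ δ₀ δ : ℝ} (hΛ : 1 < Λ) {K : ℕ}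
    (hexp : ∀ k < K, e k ≤ δ₀ → Λ * e k ≤ e (k + 1))
    (htube : ∀ k < K, e k ≤ δ₀) (hend : e K ≤ δ) (he0 : 0 < e 0) :
    (K : ℝ) ≤ Real.log (δ / e 0) / Real.log Λ := by
  have hpow : Λ ^ K ≤ δ / e 0 := by
    rw [le_div_iff₀ he0]
    exact (le_of_expansive (le_of_lt (lt_trans zero_lt_one hΛ)) hexp htube).trans hend
  have hlogΛ : 0 < Real.log Λ := Real.log_pos hΛ
  rw [le_div_iff₀ hlogΛ, ← Real.log_pow]
  exact Real.log_le_log (pow_pos (by linarith) K) hpow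

/-! ## The same for the orbit distance of a self-map -/

/-- **Orbit form of the necessity.**  `M` a self-map of a (pseudo)metric space, `w` the machine seed
(its orbit `M^[k] w` is the machine's ladder), `v` a designed seed.  If `M` expands distances to the
machine orbit by `Λ` inside the tube of radius `δ₀` around it (levels `k < K`), and the designed ladder
stays in that tube through level `K − 1`, then `Λ^K · dist v w ≤ dist (M^[K] v) (M^[K] w)`. -/
theorem dist_iterate_ge {X : Type*} [PseudoMetricSpace X] (M : X → X) {Λ δ₀ : ℝ} (hΛ : 0 ≤ Λ)
    (w v : X) {K : ℕ}
    (hexp : ∀ k < K, ∀ x, dist x (M^[k] w) ≤ δ₀ → Λ * dist x (M^[k] w) ≤ dist (M x) (M^[k + 1] w))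
    (htube : ∀ k < K, dist (M^[k] v) (M^[k] w) ≤ δ₀) :
    Λ ^ K * dist v w ≤ dist (M^[K] v) (M^[K] w) := by
  have h := le_of_expansive (e := fun k => dist (M^[k] v) (M^[k] w)) hΛ (K := K) ?_ htube
  · simpa using h
  · intro k hk hk'
    have h' := hexp k hk (M^[k] v) hk'
    rwa [← iterate_succ_apply' M k v] at h'

/-- **Orbit form of the precision floor**: with `Λ > 1`, holding level `K` within `δ` of the machine
forces `dist v w ≤ δ / Λ^K`. -/
theorem dist_precision_floor {X : Type*} [PseudoMetricSpace X] (M : X → X) {Λ δ₀ δ : ℝ}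
    (hΛ : 1 < Λ) (w v : X) {K : ℕ}
    (hexp : ∀ k < K, ∀ x, dist x (M^[k] w) ≤ δ₀ → Λ * dist x (M^[k] w) ≤ dist (M x) (M^[k + 1] w))
    (htube : ∀ k < K, dist (M^[k] v) (M^[k] w) ≤ δ₀) (hend : dist (M^[K] v) (M^[K] w) ≤ δ) :
    dist v w ≤ δ / Λ ^ K := by
  have h := precision_floor (e := fun k => dist (M^[k] v) (M^[k] w)) hΛ (K := K) ?_ htube hend
  · simpa using h
  · intro k hk hk'
    have h' := hexp k hk (M^[k] v) hk'
    rwa [← iterate_succ_apply' M k v] at h'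

/-! ## Sufficiency: discrete Grönwall -/

/-- **Discrete Grönwall.**  If the level map is `L`-Lipschitz (`L > 1`) along the ladder and each level
adds an error of size at most `σ ≥ 0` (`e (k+1) ≤ L · e k + σ`), then
`e K ≤ L^K · e 0 + σ (L^K − 1)/(L − 1)`. -/
theorem le_of_lipschitz_noise {e : ℕ → ℝ} {L σ : ℝ} (hL : 1 < L)
    (hrec : ∀ k, e (k + 1) ≤ L * e k + σ) (K : ℕ) :
    e K ≤ L ^ K * e 0 + σ * (L ^ K - 1) / (L - 1) := by
  have hne : L - 1 ≠ 0 := by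
    have : 0 < L - 1 := by linarith
    exact ne_of_gt this
  induction K with
  | zero => simp
  | succ K ih =>
    have hL0 : 0 ≤ L := by linarith
    have hstep : L * e K ≤ L * (L ^ K * e 0 + σ * (L ^ K - 1) / (L - 1)) :=
      mul_le_mul_of_nonneg_left ih hL0
    have heq : L * (L ^ K * e 0 + σ * (L ^ K - 1) / (L - 1)) + σ
        = L ^ (K + 1) * e 0 + σ * (L ^ (K + 1) - 1) / (L - 1) := by
      field_simp
      ring
    calc e (K + 1) ≤ L * e K + σ := hrec K
      _ ≤ L * (L ^ K * e 0 + σ * (L ^ K - 1) / (L - 1)) + σ := by linarith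
      _ = L ^ (K + 1) * e 0 + σ * (L ^ (K + 1) - 1) / (L - 1) := heq

/-- **Sufficient precision (the matching upper side).**  Under discrete Grönwall with `L > 1`, an initial
error `≤ δ/(2 L^K)` and per-level noise `≤ δ (L − 1)/(2 L^K)` keep level `K` within `δ`:
precision `~ L^(−K)` SUFFICES, the same law as the necessity `~ Λ^(−K)`. -/
theorem within_of_precision {e : ℕ → ℝ} {L σ δ : ℝ} (hL : 1 < L) (hδ : 0 ≤ δ)
    (hrec : ∀ k, e (k + 1) ≤ L * e k + σ) {K : ℕ}
    (hprec : e 0 ≤ δ / (2 * L ^ K)) (hnoise : σ ≤ δ * (L - 1) / (2 * L ^ K)) :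
    e K ≤ δ := by
  have hLK : 0 < L ^ K := pow_pos (by linarith) K
  have hL1 : 0 < L - 1 := by linarith
  have hLKne : L ^ K ≠ 0 := ne_of_gt hLK
  have hL1ne : L - 1 ≠ 0 := ne_of_gt hL1
  have hbound := le_of_lipschitz_noise hL hrec K
  have h1 : L ^ K * e 0 ≤ δ / 2 := by
    calc L ^ K * e 0 ≤ L ^ K * (δ / (2 * L ^ K)) := mul_le_mul_of_nonneg_left hprec (le_of_lt hLK)
      _ = δ / 2 := by field_simp
  have hfac : 0 ≤ (L ^ K - 1) / (L - 1) :=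
    div_nonneg (by linarith [one_le_pow₀ (M₀ := ℝ) (le_of_lt hL) (n := K)]) (le_of_lt hL1)
  have h2 : σ * (L ^ K - 1) / (L - 1) ≤ δ / 2 := by
    have hre : σ * (L ^ K - 1) / (L - 1) = σ * ((L ^ K - 1) / (L - 1)) := by ring
    have hid : δ * (L - 1) / (2 * L ^ K) * ((L ^ K - 1) / (L - 1)) = δ / 2 - δ / (2 * L ^ K) := by
      field_simp
    have hpos : 0 ≤ δ / (2 * L ^ K) := by positivity
    calc σ * (L ^ K - 1) / (L - 1) = σ * ((L ^ K - 1) / (L - 1)) := hre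
      _ ≤ δ * (L - 1) / (2 * L ^ K) * ((L ^ K - 1) / (L - 1)) :=
          mul_le_mul_of_nonneg_right hnoise hfac
      _ = δ / 2 - δ / (2 * L ^ K) := hid
      _ ≤ δ / 2 := by linarith
  linarith

/-! ## The cell's pins -/

/-- **Ten levels at `Λ_M = 2.5` (A-G10-1's multiplier, idea-1 P-G10-1 (h)).**  `2.5^(−10)` lies in
`(1.0·10⁻⁴, 1.05·10⁻⁴)`, and `2.5^10 ≤ 10⁴ < 2.5^11`: a designed seed `10⁻⁴` (rad) off the machine holds
at most ten levels within `O(1)` — idea-1's "ten levels: ~10⁻⁴ rad", as arithmetic. -/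
theorem tenLevels_numbers :
    (1.0e-4 : ℝ) < ((2.5 : ℝ) ^ 10)⁻¹ ∧ ((2.5 : ℝ) ^ 10)⁻¹ < 1.05e-4 ∧
      (2.5 : ℝ) ^ 10 ≤ 1e4 ∧ (1e4 : ℝ) < (2.5 : ℝ) ^ 11 := by
  refine ⟨?_, ?_, ?_, ?_⟩ <;> norm_num

end Summit.NavierStokesRegularity.FluidComputer.RGPhasePrecision
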